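import Summits.CriticalPhenomena.PercolationContinuityZ3.Theorems.PercNearOneGluingNoHeavyLowerTailSingletonPocketPackingFamilyAux
import HarnessLib

/-!
# `NoHeavyLowerTail` (stmt-CriticalPhenomena-4575) — SINGLETON-POCKET PACKING for a general up-family of heavy relay
# sets, and Kozma–Nitzan's connection-to-`b` form

Support file (coupling seat `prim-cplus-coupling`, gen 2; `--supports stmt-CriticalPhenomena-4575`).  No definitions,
no named facts, no sorries.

Bond percolation `μ = prodBernoulli w` on `Fin n`, relays `A`, `π(v) = A.filter (fun z => ω ∈ openConn v z)`, a family `𝓗`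
of subsets of `A` closed upward inside `A`; `v` is 𝓗-heavy when `π(v) ∈ 𝓗`, an 𝓗-CHAMPION is a relay `c` maximising
`μ(π(·) ∉ 𝓗)` over `A`.

* `singletonPocket_le_heavy_family` — for an 𝓗-champion `c` with `{c} ∉ 𝓗` (all relays simultaneously separable with
  positive probability):  `μ(|π(o)| = 1, π(c) ∈ 𝓗) ≤ μ(π(o) ∈ 𝓗, o ↮ c)`.  The cardinality family `{T : j < |T|}` is
  the landed `singletonPocket_le_heavy`; the proof is the same (BHK 1.4 decoupling given `{t isolated}`, the champion
  hypothesis, Kozma–Nitzan's Lemma 2 packing, BHK 1.3 recoupling), with the 𝓗-free steps reused.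
* `singletonExit_le` — the connection-to-`b` form (relays `A ∪ {b}`, `𝓗 = {T ∋ b}`): for `b ∉ A`, an observer `o` and
  `c ∈ A` MINIMISING `μ(a ↔ b)` over `A` (all of `A ∪ {b}` simultaneously separable with positive probability),
      `μ(∃ a ∈ A, π_A(o) = {a}, o ↮ b, c ↔ b) ≤ μ(o ↔ b, o ↮ c)`
  — "an exit through a SINGLE relay while the worst relay reaches `b`" is rarer than "`o` reaches `b` avoiding the worst
  relay".  For `|A| = 2` this is Kozma–Nitzan's Theorem 1 (pre-FKG conjecture (3) at `|A| = 2`); for general `A` it is the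
  singleton-pocket part of (3) / of the event-gluing inequality EG_k, packed with constant `1`.
[cite: KozmaNitzan2024, Lemma 2 p. 6, Theorem 1 p. 7, Conjecture 2 / (3) p. 3; VandenbergHaggstromKahn2005, Thms. 1.3–1.4]
-/

noncomputable section

namespace Summit.CriticalPhenomena.PercolationContinuityZ3.Theorems

open MeasureTheory Set Literature.Probability.LatticeModels Literature.Probability.Percolation
open scoped Classical BigOperators

namespace SingletonPocketPackingFamily

variable {n : ℕ}

/-- **Steps 1–2 for one relay `t ≠ c`.**  `μ(t isolated, t ↔ o, c heavy) ≤ ψ_t · Σ_{T ∋ t heavy, T ⊆ A ∖ c} μ(T is a block)`,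
under the champion hypothesis for the pair `(t, c)`. [folklore] -/
theorem per_relay (w : Sym2 (Fin n) → unitInterval) (A : Finset (Fin n)) (𝓗 : Finset (Finset (Fin n)))
    (hup : ∀ T ∈ 𝓗, ∀ T' : Finset (Fin n), T ⊆ T' → T' ⊆ A → T' ∈ 𝓗) (o : Fin n) {t c : Fin n}
    (htA : t ∈ A) (hc : c ∈ A.erase t)
    (hle : (prodBernoulli w).real {ω : BondConfig (Fin n) | (A.filter fun z => ω ∈ openConn t z) ∉ 𝓗} ≤
      (prodBernoulli w).real {ω : BondConfig (Fin n) | (A.filter fun z => ω ∈ openConn c z) ∉ 𝓗}) :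
    (prodBernoulli w).real ({ω : BondConfig (Fin n) | ∀ s ∈ ({t} : Finset (Fin n)), ∀ x ∈ A.erase t,
        ¬ (openGraph ω).Reachable s x} ∩ ((⋃ s ∈ ({t} : Finset (Fin n)), (openConn s o : Set (BondConfig (Fin n)))) ∩
          {ω : BondConfig (Fin n) | (A.filter fun z => ω ∈ openConn c z) ∈ 𝓗})) ≤
      (prodBernoulli w).real ({ω : BondConfig (Fin n) | ∀ x ∈ A.erase t, ¬ (openGraph ω).Reachable t x} ∩ openConn t o) /
          (prodBernoulli w).real {ω : BondConfig (Fin n) | ∀ x ∈ A.erase t, ¬ (openGraph ω).Reachable t x} *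
        ∑ T ∈ ((A.erase c).powerset.filter fun T => T ∈ 𝓗).filter (fun T => t ∈ T),
          (prodBernoulli w).real {ω : BondConfig (Fin n) | ∀ s ∈ T, (A.filter fun z => ω ∈ openConn s z) = T} := by
  set μ := prodBernoulli w with hμ
  have S1 := isolated_conn_heavy w A 𝓗 hup t o c hc
  set D : Set (BondConfig (Fin n)) :=
    {ω : BondConfig (Fin n) | ∀ s ∈ ({t} : Finset (Fin n)), ∀ x ∈ A.erase t, ¬ (openGraph ω).Reachable s x} with hD
  set D' : Set (BondConfig (Fin n)) := {ω : BondConfig (Fin n) | ∀ x ∈ A.erase t, ¬ (openGraph ω).Reachable t x} with hD'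
  set Co : Set (BondConfig (Fin n)) := ⋃ s ∈ ({t} : Finset (Fin n)), (openConn s o : Set (BondConfig (Fin n))) with hCo
  set Hc : Set (BondConfig (Fin n)) := {ω : BondConfig (Fin n) | (A.filter fun z => ω ∈ openConn c z) ∈ 𝓗} with hHc
  set Ht : Set (BondConfig (Fin n)) := {ω : BondConfig (Fin n) | (A.filter fun z => ω ∈ openConn t z) ∈ 𝓗} with hHt
  have hDD' : D = D' := by
    ext ω; simp only [hD, hD', Set.mem_setOf_eq, Finset.mem_singleton, forall_eq]
  have hCo' : Co = (openConn t o : Set (BondConfig (Fin n))) := by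
    rw [hCo]; exact Finset.set_biUnion_singleton t _
  -- (a) the light term is at most ψ_t · μ(D ∩ Hc)
  have hψnn : 0 ≤ μ.real (D' ∩ openConn t o) / μ.real D' := div_nonneg measureReal_nonneg measureReal_nonneg
  have ha : μ.real (D ∩ (Co ∩ Hc)) ≤ μ.real (D' ∩ openConn t o) / μ.real D' * μ.real (D ∩ Hc) := by
    by_cases hD0 : μ.real D = 0
    · have : μ.real (D ∩ (Co ∩ Hc)) = 0 :=
        le_antisymm (le_trans (measureReal_mono Set.inter_subset_left (measure_ne_top _ _)) (le_of_eq hD0)) measureReal_nonneg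
      rw [this]; exact mul_nonneg hψnn measureReal_nonneg
    · have hDpos : 0 < μ.real D := lt_of_le_of_ne measureReal_nonneg (Ne.symm hD0)
      rw [← hDD', ← hCo', div_mul_eq_mul_div, le_div_iff₀ hDpos]
      linarith [S1]
  -- (b) `D ∩ Hc ⊆ {t ↮ c} ∩ Hc`, then the champion hypothesis, then the block decomposition
  have hct : c ≠ t := (Finset.mem_erase.1 hc).1
  have hb1 : μ.real (D ∩ Hc) ≤ μ.real ((openConn t c : Set (BondConfig (Fin n)))ᶜ ∩ Hc) := by
    refine measureReal_mono (fun ω hω => ⟨?_, hω.2⟩) (measure_ne_top _ _)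
    exact hω.1 t (Finset.mem_singleton_self t) c hc
  have hb2 := heavy_transfer w A 𝓗 t c hle
  have hb3 : μ.real ((openConn t c : Set (BondConfig (Fin n)))ᶜ ∩ Ht) ≤
      ∑ T ∈ ((A.erase c).powerset.filter fun T => T ∈ 𝓗).filter (fun T => t ∈ T),
        μ.real {ω : BondConfig (Fin n) | ∀ s ∈ T, (A.filter fun z => ω ∈ openConn s z) = T} :=
    le_trans (measureReal_mono (heavy_subset_blocks A 𝓗 htA c) (measure_ne_top _ _))
      (measureReal_biUnion_finset_le _ _)
  calc μ.real (D ∩ (Co ∩ Hc)) ≤ μ.real (D' ∩ openConn t o) / μ.real D' * μ.real (D ∩ Hc) := ha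
    _ ≤ μ.real (D' ∩ openConn t o) / μ.real D' *
        ∑ T ∈ ((A.erase c).powerset.filter fun T => T ∈ 𝓗).filter (fun T => t ∈ T),
          μ.real {ω : BondConfig (Fin n) | ∀ s ∈ T, (A.filter fun z => ω ∈ openConn s z) = T} :=
        mul_le_mul_of_nonneg_left (le_trans hb1 (le_trans hb2 hb3)) hψnn

end SingletonPocketPackingFamily

variable {n : ℕ}

open SingletonPocketPackingFamily in
/-- **Singleton-pocket packing for an up-family of heavy sets (coupling seat, `NoHeavyLowerTail` calculus).**  Bond percolation
`μ = prodBernoulli w` on `Fin n`, relays `A`, a family `𝓗` of subsets of `A` closed upward inside `A`, an observer `o`, and an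
𝓗-champion `c ∈ A` (`μ(π(a) ∉ 𝓗) ≤ μ(π(c) ∉ 𝓗)` for all `a ∈ A`) with `{c} ∉ 𝓗`.  If all relays are simultaneously
separable with positive probability, then

  `μ(|π(o)| = 1, π(c) ∈ 𝓗) ≤ μ(π(o) ∈ 𝓗, o ↮ c)`.

`𝓗 = {T ⊆ A : j < |T|}` is `singletonPocket_le_heavy`; `𝓗 = {T ∋ b}` on the relay set `A ∪ {b}` gives Kozma–Nitzan's
connection-to-`b` form (`singletonExit_le`); weighted relays: `𝓗 = {T : j < Σ_{t ∈ T} m_t}`.  Same proof: `lonely_subset`,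
`per_relay`, the sum swap, `SingletonPocketPacking.packing`, `blockConn_subset`, `SingletonPocketPacking.blockConn_disjoint`.
[cite: KozmaNitzan2024, Lemma 2 p. 6, Theorem 1 p. 7; VandenbergHaggstromKahn2005, Thms. 1.3–1.4] -/
theorem singletonPocket_le_heavy_family (w : Sym2 (Fin n) → unitInterval) (A : Finset (Fin n))
    (𝓗 : Finset (Finset (Fin n))) (hup : ∀ T ∈ 𝓗, ∀ T' : Finset (Fin n), T ⊆ T' → T' ⊆ A → T' ∈ 𝓗)
    (o : Fin n) {c : Fin n} (hcA : c ∈ A) (hc1 : ({c} : Finset (Fin n)) ∉ 𝓗)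
    (hchamp : ∀ a ∈ A, (prodBernoulli w).real {ω : BondConfig (Fin n) | (A.filter fun z => ω ∈ openConn a z) ∉ 𝓗} ≤
      (prodBernoulli w).real {ω : BondConfig (Fin n) | (A.filter fun z => ω ∈ openConn c z) ∉ 𝓗})
    (hM : 0 < (prodBernoulli w).real {ω : BondConfig (Fin n) | ∀ k ∈ A, ∀ l ∈ A, k ≠ l → ¬ (openGraph ω).Reachable k l}) :
    (prodBernoulli w).real {ω : BondConfig (Fin n) | (A.filter fun z => ω ∈ openConn o z).card = 1 ∧
        (A.filter fun z => ω ∈ openConn c z) ∈ 𝓗} ≤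
      (prodBernoulli w).real {ω : BondConfig (Fin n) | (A.filter fun z => ω ∈ openConn o z) ∈ 𝓗 ∧
        ω ∉ openConn o c} := by
  set μ := prodBernoulli w with hμ
  set 𝒯 : Finset (Finset (Fin n)) := (A.erase c).powerset.filter fun T => T ∈ 𝓗 with h𝒯
  -- abbreviations for the recurring functions of `t` and `T`
  set ψ : Fin n → ℝ := fun t =>
    μ.real ({ω : BondConfig (Fin n) | ∀ x ∈ A.erase t, ¬ (openGraph ω).Reachable t x} ∩ openConn t o) /
      μ.real {ω : BondConfig (Fin n) | ∀ x ∈ A.erase t, ¬ (openGraph ω).Reachable t x} with hψ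
  set blk : Finset (Fin n) → Set (BondConfig (Fin n)) := fun T =>
    {ω : BondConfig (Fin n) | ∀ s ∈ T, (A.filter fun z => ω ∈ openConn s z) = T} with hblk
  set G : Finset (Fin n) → Set (BondConfig (Fin n)) := fun T =>
    blk T ∩ ⋃ s ∈ T, (openConn s o : Set (BondConfig (Fin n))) with hG
  set light : Fin n → Set (BondConfig (Fin n)) := fun t =>
    {ω : BondConfig (Fin n) | ∀ s ∈ ({t} : Finset (Fin n)), ∀ x ∈ A.erase t, ¬ (openGraph ω).Reachable s x} ∩
      ((⋃ s ∈ ({t} : Finset (Fin n)), (openConn s o : Set (BondConfig (Fin n)))) ∩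
        {ω : BondConfig (Fin n) | (A.filter fun z => ω ∈ openConn c z) ∈ 𝓗}) with hlight
  -- Step 0
  have h0 : μ.real {ω : BondConfig (Fin n) | (A.filter fun z => ω ∈ openConn o z).card = 1 ∧
      (A.filter fun z => ω ∈ openConn c z) ∈ 𝓗} ≤ ∑ t ∈ A.erase c, μ.real (light t) :=
    le_trans (measureReal_mono (lonely_subset A 𝓗 o c hc1) (measure_ne_top _ _)) (measureReal_biUnion_finset_le _ _)
  -- Steps 1–2
  have h12 : ∑ t ∈ A.erase c, μ.real (light t) ≤
      ∑ t ∈ A.erase c, ψ t * ∑ T ∈ 𝒯.filter (fun T => t ∈ T), μ.real (blk T) := by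
    refine Finset.sum_le_sum fun t ht => ?_
    have htA : t ∈ A := Finset.mem_of_mem_erase ht
    have hc : c ∈ A.erase t := Finset.mem_erase.2 ⟨fun h => (Finset.mem_erase.1 ht).1 h.symm, hcA⟩
    exact per_relay w A 𝓗 hup o htA hc (hchamp t htA)
  -- the sum swap
  have hswap : ∑ t ∈ A.erase c, ψ t * ∑ T ∈ 𝒯.filter (fun T => t ∈ T), μ.real (blk T) =
      ∑ T ∈ 𝒯, (∑ t ∈ T, ψ t) * μ.real (blk T) := by
    have e1 : ∀ t ∈ A.erase c, ψ t * ∑ T ∈ 𝒯.filter (fun T => t ∈ T), μ.real (blk T) =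
        ∑ T ∈ 𝒯, if t ∈ T then ψ t * μ.real (blk T) else 0 := by
      intro t _
      rw [Finset.mul_sum, Finset.sum_filter]
    rw [Finset.sum_congr rfl e1, Finset.sum_comm]
    refine Finset.sum_congr rfl fun T hT => ?_
    have hTsub : T ⊆ A.erase c := by
      rw [h𝒯, Finset.mem_filter, Finset.mem_powerset] at hT; exact hT.1
    rw [← Finset.sum_filter, Finset.filter_mem_eq_inter, Finset.inter_eq_right.2 hTsub, Finset.sum_mul]
  -- Step 3
  have h3 : ∑ T ∈ 𝒯, (∑ t ∈ T, ψ t) * μ.real (blk T) ≤ ∑ T ∈ 𝒯, μ.real (G T) := by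
    refine Finset.sum_le_sum fun T hT => ?_
    have hTsub : T ⊆ A.erase c := by
      rw [h𝒯, Finset.mem_filter, Finset.mem_powerset] at hT; exact hT.1
    have hTA : T ⊆ A := fun x hx => Finset.mem_of_mem_erase (hTsub hx)
    have hMT : 0 < μ.real {ω : BondConfig (Fin n) | ∀ k ∈ T, ∀ l ∈ A, k ≠ l → ¬ (openGraph ω).Reachable k l} :=
      lt_of_lt_of_le hM (measureReal_mono (fun ω hω k hk l hl hkl => hω k (hTA hk) l hl hkl) (measure_ne_top _ _))
    exact SingletonPocketPacking.packing w A T o hTA hMT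
  -- Step 4
  have h4 : ∑ T ∈ 𝒯, μ.real (G T) ≤ μ.real {ω : BondConfig (Fin n) | (A.filter fun z => ω ∈ openConn o z) ∈ 𝓗 ∧
      ω ∉ openConn o c} := by
    rw [← measureReal_biUnion_finset (SingletonPocketPacking.blockConn_disjoint A o 𝒯) (fun T _ => MeasurableSet.of_discrete)]
    refine measureReal_mono ?_ (measure_ne_top _ _)
    exact Set.iUnion₂_subset fun T hT => blockConn_subset A 𝓗 o hcA hT
  calc μ.real {ω : BondConfig (Fin n) | (A.filter fun z => ω ∈ openConn o z).card = 1 ∧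
          (A.filter fun z => ω ∈ openConn c z) ∈ 𝓗}
        ≤ ∑ t ∈ A.erase c, μ.real (light t) := h0
    _ ≤ ∑ t ∈ A.erase c, ψ t * ∑ T ∈ 𝒯.filter (fun T => t ∈ T), μ.real (blk T) := h12
    _ = ∑ T ∈ 𝒯, (∑ t ∈ T, ψ t) * μ.real (blk T) := hswap
    _ ≤ ∑ T ∈ 𝒯, μ.real (G T) := h3
    _ ≤ μ.real {ω : BondConfig (Fin n) | (A.filter fun z => ω ∈ openConn o z) ∈ 𝓗 ∧ ω ∉ openConn o c} := h4



open SingletonPocketPackingFamily in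
/-- **Singleton exits are dominated (Kozma–Nitzan's connection-to-`b` form of singleton-pocket packing).**  For a finite
weighted graph, a relay set `A`, a vertex `b ∉ A`, an observer `o`, and a relay `c ∈ A` MINIMISING `μ(a ↔ b)` over `a ∈ A`
(all of `A ∪ {b}` simultaneously separable with positive probability):

  `μ(∃ a ∈ A, π_A(o) = {a}, o ↮ b, c ↔ b) ≤ μ(o ↔ b, o ↮ c)`.

(`singletonPocket_le_heavy_family` for the relay set `A ∪ {b}` and the up-family `{T ∋ b}`.)  For `|A| = 2` this is
Kozma–Nitzan's Theorem 1; in general it is the singleton-pocket part of their pre-FKG inequality (3), with constant `1`.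
[cite: KozmaNitzan2024, Theorem 1 p. 7, (3) p. 3; VandenbergHaggstromKahn2005, Thms. 1.3–1.4] -/
theorem singletonExit_le (w : Sym2 (Fin n) → unitInterval) (A : Finset (Fin n)) (o b : Fin n) {c : Fin n}
    (hcA : c ∈ A) (hbA : b ∉ A)
    (hmin : ∀ a ∈ A, (prodBernoulli w).real (openConn c b : Set (BondConfig (Fin n))) ≤
      (prodBernoulli w).real (openConn a b : Set (BondConfig (Fin n))))
    (hM : 0 < (prodBernoulli w).real {ω : BondConfig (Fin n) | ∀ k ∈ insert b A, ∀ l ∈ insert b A,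
      k ≠ l → ¬ (openGraph ω).Reachable k l}) :
    (prodBernoulli w).real {ω : BondConfig (Fin n) | ∃ a ∈ A, (A.filter fun z => ω ∈ openConn o z) = {a} ∧
        ω ∉ openConn o b ∧ ω ∈ openConn c b} ≤
      (prodBernoulli w).real {ω : BondConfig (Fin n) | ω ∈ openConn o b ∧ ω ∉ openConn o c} := by
  set μ := prodBernoulli w with hμ
  set A' : Finset (Fin n) := insert b A with hA'
  set 𝓗 : Finset (Finset (Fin n)) := A'.powerset.filter fun T => b ∈ T with h𝓗
  have hbA' : b ∈ A' := Finset.mem_insert_self b A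
  have hcA' : c ∈ A' := Finset.mem_insert_of_mem hcA
  have hcb : c ≠ b := fun h => hbA (h ▸ hcA)
  have hup : ∀ T ∈ 𝓗, ∀ T' : Finset (Fin n), T ⊆ T' → T' ⊆ A' → T' ∈ 𝓗 := by
    intro T hT T' hTT' hT'A
    rw [h𝓗, Finset.mem_filter, Finset.mem_powerset] at hT ⊢
    exact ⟨hT'A, hTT' hT.2⟩
  have hc1 : ({c} : Finset (Fin n)) ∉ 𝓗 := by
    rw [h𝓗, Finset.mem_filter, Finset.mem_singleton]
    exact fun h => hcb h.2.symm
  -- `π_{A'}(v) ∉ 𝓗 ↔ v ↮ b`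
  have hlight : ∀ v : Fin n, {ω : BondConfig (Fin n) | (A'.filter fun z => ω ∈ openConn v z) ∉ 𝓗} =
      (openConn v b : Set (BondConfig (Fin n)))ᶜ := by
    intro v; ext ω
    simp only [h𝓗, Set.mem_setOf_eq, Set.mem_compl_iff, Finset.mem_filter, Finset.mem_powerset,
      Finset.filter_subset, true_and, hbA']
  have hchamp : ∀ a ∈ A', μ.real {ω : BondConfig (Fin n) | (A'.filter fun z => ω ∈ openConn a z) ∉ 𝓗} ≤
      μ.real {ω : BondConfig (Fin n) | (A'.filter fun z => ω ∈ openConn c z) ∉ 𝓗} := by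
    intro a ha
    rw [hlight a, hlight c]
    rw [hA', Finset.mem_insert] at ha
    rcases ha with rfl | ha
    · have : (openConn a a : Set (BondConfig (Fin n)))ᶜ = ∅ := by
        ext ω
        simp only [Set.mem_compl_iff, Set.mem_empty_iff_false, iff_false, not_not]
        exact (SimpleGraph.Reachable.refl a : (openGraph ω).Reachable a a)
      rw [this, measureReal_empty]; exact measureReal_nonneg
    · rw [probReal_compl_eq_one_sub MeasurableSet.of_discrete, probReal_compl_eq_one_sub MeasurableSet.of_discrete]
      linarith [hmin a ha]
  have key := singletonPocket_le_heavy_family w A' 𝓗 hup o hcA' hc1 hchamp hM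
  refine le_trans (measureReal_mono ?_ (measure_ne_top _ _)) (le_trans key (measureReal_mono ?_ (measure_ne_top _ _)))
  · rintro ω ⟨a, haA, hfil, hob, hcb'⟩
    refine ⟨?_, ?_⟩
    · show (A'.filter fun z => ω ∈ openConn o z).card = 1
      rw [hA', Finset.filter_insert, if_neg hob, hfil, Finset.card_singleton]
    · show (A'.filter fun z => ω ∈ openConn c z) ∈ 𝓗
      rw [h𝓗, Finset.mem_filter, Finset.mem_powerset]
      exact ⟨Finset.filter_subset _ _, Finset.mem_filter.2 ⟨hbA', hcb'⟩⟩
  · rintro ω ⟨hH, hoc⟩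
    refine ⟨?_, hoc⟩
    have hH' : (A'.filter fun z => ω ∈ openConn o z) ∈ 𝓗 := hH
    rw [h𝓗, Finset.mem_filter] at hH'
    exact (Finset.mem_filter.1 hH'.2).2

end Summit.CriticalPhenomena.PercolationContinuityZ3.Theorems
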